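import Literature.Geometry.Manifold.ProperFunctionTube
import Mathlib.Analysis.InnerProductSpace.Calculus
import Mathlib.Analysis.InnerProductSpace.PiL2
import HarnessLib

/-!
# The levels of a map that submerses onto the open unit disc are homeomorphic

General differential topology (topic `Geometry/Manifold`; everything here is PROVED — one small
definition, no named facts), a two-dimensional-base companion of `RegularLevelSets.lean`
(Hirsch 1976, Ch. 6 §2, Thm. 2.2: all regular levels of a proper function are diffeomorphic;
Bröcker–Jänich 1982, (8.12): Ehresmann's fibration theorem).  Let `N` be a compact Hausdorff
second countable `C^∞` manifold over a finite-dimensional boundaryless model and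
`g : N → ℝ²` smooth with `dg_y` onto wherever `‖g y‖ < 1` (the shape of the boundary fibration of
a Lefschetz fibration over the disc, `Literature.Geometry.Symplectic.PALF.boundary_submersion`).
Then for all `c₀, c₁` in the open unit disc the levels `g⁻¹(c₀)`, `g⁻¹(c₁)` are homeomorphic
(`nonempty_homeomorph_level_of_norm_lt_one`).

Proof: on the open submanifold `U = {‖g‖ < 1}` the map `G = ψ ∘ g`, with the radial stretch
`ψ(u) = (1 - ‖u‖²)⁻¹ u` of the open disc onto the plane (`radialStretch`: smooth on the open
disc, injective, with injective — hence invertible — differential, and `‖u‖ ≤ 2R/(1 + 2R)`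
when `‖ψ u‖ ≤ R`), is smooth with onto differential and compact preimages of closed balls; the
flow of a lift of the constant field `ψ c₁ - ψ c₀` (`exists_contMDiff_lift_of_surjective_mfderiv`,
`exists_globalFlow_of_lift`) translates `G`, and its time-one map carries `g⁻¹(c₀)` onto
`g⁻¹(c₁)`.

## References

* M. W. Hirsch, *Differential Topology*, GTM 33 (1976), Ch. 6 §2, Thm. 2.2. [HirschDT1976]
* Th. Bröcker, K. Jänich, *Introduction to Differential Topology* (1982), (8.12).
  [BrockerJanichIDT1982]
-/

open scoped Manifold ContDiff Topology RealInnerProductSpace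
open Set Function Filter Metric

noncomputable section

namespace Literature.Geometry.Manifold

universe u

/-! ### The radial stretch of the open unit disc onto the plane -/

section Stretch

variable {V : Type*} [NormedAddCommGroup V] [InnerProductSpace ℝ V]

/-- **The radial stretch** `ψ(u) = (1 - ‖u‖²)⁻¹ • u` (a diffeomorphism of the open unit ball
onto the whole space; outside the ball the formula is junk). [folklore] -/
def radialStretch (u : V) : V := (1 - ‖u‖ ^ 2)⁻¹ • u

/-- Unfolding the radial stretch. [folklore] -/
theorem radialStretch_apply (u : V) : radialStretch u = (1 - ‖u‖ ^ 2)⁻¹ • u := rfl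

/-- The stretch fixes the origin. [folklore] -/
@[simp] theorem radialStretch_zero : radialStretch (0 : V) = 0 := by simp [radialStretch]

omit [InnerProductSpace ℝ V] in
/-- The stretch factor is positive on the open ball. [folklore] -/
theorem one_sub_norm_sq_pos {u : V} (hu : ‖u‖ < 1) : 0 < 1 - ‖u‖ ^ 2 := by
  nlinarith [norm_nonneg u]

/-- `‖ψ u‖ = ‖u‖ / (1 - ‖u‖²)` on the open ball. [folklore] -/
theorem norm_radialStretch {u : V} (hu : ‖u‖ < 1) : ‖radialStretch u‖ = ‖u‖ / (1 - ‖u‖ ^ 2) := by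
  rw [radialStretch, norm_smul, Real.norm_eq_abs, abs_inv, abs_of_pos (one_sub_norm_sq_pos hu),
    div_eq_inv_mul]

/-- **Properness of the stretch**: `‖ψ u‖ ≤ R` forces `‖u‖ ≤ 2R / (1 + 2R) < 1`. [folklore] -/
theorem norm_le_of_norm_radialStretch_le {u : V} (hu : ‖u‖ < 1) {R : ℝ} (hR : ‖radialStretch u‖ ≤ R) :
    ‖u‖ ≤ 2 * R / (1 + 2 * R) := by
  rw [norm_radialStretch hu] at hR
  have hpos := one_sub_norm_sq_pos hu
  have hR0 : 0 ≤ R := le_trans (div_nonneg (norm_nonneg _) hpos.le) hR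
  rw [div_le_iff₀ hpos] at hR
  have h1 : 1 - ‖u‖ ^ 2 ≤ 2 * (1 - ‖u‖) := by nlinarith [norm_nonneg u]
  have h2 : ‖u‖ ≤ 2 * R * (1 - ‖u‖) := hR.trans (by nlinarith)
  rw [le_div_iff₀ (by linarith)]
  nlinarith

/-- The stretch is injective on the open ball. [folklore] -/
theorem radialStretch_injOn : InjOn (radialStretch (V := V)) (ball 0 1) := by
  intro u hu u' hu' h
  rw [mem_ball_zero_iff] at hu hu'
  have hn : ‖radialStretch u‖ = ‖radialStretch u'‖ := by rw [h]
  rw [norm_radialStretch hu, norm_radialStretch hu'] at hn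
  have hpos := one_sub_norm_sq_pos hu
  have hpos' := one_sub_norm_sq_pos hu'
  -- the radial profile `r ↦ r / (1 - r²)` is injective on `[0, 1)`
  have heq : ‖u‖ = ‖u'‖ := by
    rw [div_eq_div_iff hpos.ne' hpos'.ne'] at hn
    have key : (‖u'‖ - ‖u‖) * (1 + ‖u‖ * ‖u'‖) = 0 := by
      have : ‖u'‖ * (1 - ‖u‖ ^ 2) - ‖u‖ * (1 - ‖u'‖ ^ 2) = (‖u'‖ - ‖u‖) * (1 + ‖u‖ * ‖u'‖) := by
        ring
      rw [← this, hn, sub_self]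
    have hpos'' : 0 < 1 + ‖u‖ * ‖u'‖ := by positivity
    rcases mul_eq_zero.1 key with h | h
    · linarith
    · linarith
  have h' : (1 - ‖u‖ ^ 2)⁻¹ • u = (1 - ‖u‖ ^ 2)⁻¹ • u' := by
    have := h; rw [radialStretch, radialStretch, ← heq] at this; exact this
  exact smul_right_injective V (inv_ne_zero hpos.ne') h'

/-- The stretch is smooth on the open ball. [folklore] -/
theorem contDiffOn_radialStretch : ContDiffOn ℝ ∞ (radialStretch (V := V)) (ball 0 1) := by
  refine ContDiffOn.smul (ContDiffOn.inv ?_ fun u hu => ?_) contDiffOn_id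
  · exact (contDiffOn_const.sub ((contDiff_norm_sq ℝ).contDiffOn))
  · rw [mem_ball_zero_iff] at hu
    exact (one_sub_norm_sq_pos hu).ne'

/-- The differential of the stretch: `dψ_u(v) = h v + 2 h² ⟪u, v⟫ u`, `h = (1 - ‖u‖²)⁻¹`. [folklore] -/
theorem exists_hasFDerivAt_radialStretch {u : V} (hu : ‖u‖ < 1) :
    ∃ L : V →L[ℝ] V, HasFDerivAt (radialStretch (V := V)) L u ∧
      ∀ v, L v = (1 - ‖u‖ ^ 2)⁻¹ • v + (2 * ((1 - ‖u‖ ^ 2) ^ 2)⁻¹ * ⟪u, v⟫) • u := by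
  have hpos := one_sub_norm_sq_pos hu
  -- derivative of `q(v) = 1 - ‖v‖²`
  have h1 : HasFDerivAt (fun v : V => 1 - ‖v‖ ^ 2) (-(2 • innerSL ℝ u)) u := by
    have h := ((hasFDerivAt_id u).norm_sq).const_sub 1
    refine h.congr_fderiv ?_
    ext w
    simp [two_smul]
  -- derivative of `h = q⁻¹`
  have h2 : HasFDerivAt (fun v : V => (1 - ‖v‖ ^ 2)⁻¹)
      ((ContinuousLinearMap.toSpanSingleton ℝ (-((1 - ‖u‖ ^ 2) ^ 2)⁻¹)).comp (-(2 • innerSL ℝ u))) u :=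
    (hasFDerivAt_inv hpos.ne').comp u h1
  -- product rule
  have h3 := h2.smul (hasFDerivAt_id u)
  refine ⟨_, h3, fun v => ?_⟩
  simp only [add_apply, smul_apply,
    ContinuousLinearMap.smulRight_apply, ContinuousLinearMap.coe_comp, comp_apply,
    neg_apply, innerSL_apply_apply, ContinuousLinearMap.toSpanSingleton_apply,
    ContinuousLinearMap.coe_id', id_eq, smul_eq_mul]
  congr 1
  ring_nf

/-- **The differential of the stretch is injective** (`⟪dψ_u v, v⟫ = h‖v‖² + 2h²⟪u, v⟫² > 0`
for `v ≠ 0`), hence onto. [folklore] -/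
theorem surjective_fderiv_radialStretch [FiniteDimensional ℝ V] {u : V} (hu : ‖u‖ < 1) :
    Surjective (fderiv ℝ (radialStretch (V := V)) u) := by
  obtain ⟨L, hL, hLv⟩ := exists_hasFDerivAt_radialStretch hu
  rw [hL.fderiv]
  have hpos := one_sub_norm_sq_pos hu
  have hinj : Injective L := by
    refine (injective_iff_map_eq_zero L).2 fun v hv => ?_
    have h0 : ⟪L v, v⟫ = 0 := by rw [hv, inner_zero_left]
    rw [hLv v, inner_add_left, inner_smul_left, inner_smul_left, real_inner_self_eq_norm_sq] at h0
    simp only [conj_trivial] at h0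
    have h1 : 0 ≤ 2 * ((1 - ‖u‖ ^ 2) ^ 2)⁻¹ * ⟪u, v⟫ * ⟪u, v⟫ := by
      have : 0 ≤ ((1 - ‖u‖ ^ 2) ^ 2)⁻¹ := by positivity
      nlinarith [mul_self_nonneg ⟪u, v⟫]
    have h2 : (1 - ‖u‖ ^ 2)⁻¹ * ‖v‖ ^ 2 = 0 := by
      have h3 : 0 ≤ (1 - ‖u‖ ^ 2)⁻¹ * ‖v‖ ^ 2 := by positivity
      linarith
    rcases mul_eq_zero.1 h2 with h | h
    · exact absurd h (inv_ne_zero hpos.ne')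
    · exact norm_eq_zero.1 (pow_eq_zero_iff two_ne_zero |>.1 h)
  exact LinearMap.surjective_of_injective (f := L.toLinearMap) hinj

end Stretch


/-! ### Levels of a map submersing onto the open unit ball -/

section Levels

variable {E : Type u} [NormedAddCommGroup E] [NormedSpace ℝ E] [FiniteDimensional ℝ E] [CompleteSpace E]
  {H : Type*} [TopologicalSpace H] {I : ModelWithCorners ℝ E H} [I.Boundaryless]
  {N : Type*} [TopologicalSpace N] [ChartedSpace H N] [IsManifold I ∞ N] [T2Space N]
  [SecondCountableTopology N] [CompactSpace N]
  {F : Type*} [NormedAddCommGroup F] [InnerProductSpace ℝ F] [FiniteDimensional ℝ F]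

/-- **All levels over the open unit ball of a map that submerses there are homeomorphic**
(Hirsch 1976, Ch. 6 §2, Thm. 2.2; Ehresmann): for `g : N → F` smooth on the compact manifold
`N` (boundaryless finite-dimensional model) with `dg_y` onto whenever `‖g y‖ < 1`, and
`‖c₀‖, ‖c₁‖ < 1`, the levels `g⁻¹(c₀)` and `g⁻¹(c₁)` are homeomorphic — by the time-one map of
the flow translating `ψ ∘ g` by `ψ c₁ - ψ c₀` on the open submanifold `{‖g‖ < 1}`, `ψ` the
radial stretch. [cite: HirschDT1976, Ch. 6 §2, Thm. 2.2 (PDF p. 144)]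
[cite: BrockerJanichIDT1982, (8.12)] -/
theorem nonempty_homeomorph_level_of_norm_lt_one {g : N → F} (hg : ContMDiff I 𝓘(ℝ, F) ∞ g)
    (hsub : ∀ y, ‖g y‖ < 1 → Surjective (mfderiv I 𝓘(ℝ, F) g y))
    {c₀ c₁ : F} (hc₀ : ‖c₀‖ < 1) (hc₁ : ‖c₁‖ < 1) :
    Nonempty ({y : N // g y = c₀} ≃ₜ {y : N // g y = c₁}) := by
  classical
  haveI : LocallyCompactSpace N := Manifold.locallyCompact_of_finiteDimensional I
  set U : TopologicalSpace.Opens N :=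
    ⟨{y | ‖g y‖ < 1}, isOpen_lt (continuous_norm.comp hg.continuous) continuous_const⟩ with hU
  have hmemU : ∀ {y : N}, y ∈ U ↔ ‖g y‖ < 1 := Iff.rfl
  haveI : LocallyCompactSpace U := U.2.locallyCompactSpace
  -- the stretched map on the open submanifold
  set G : U → F := fun y => radialStretch (g y.1) with hG
  have hg' : ContMDiff I 𝓘(ℝ, F) ∞ fun y : U => g y.1 := hg.comp contMDiff_subtype_val
  have hGs : ContMDiff I 𝓘(ℝ, F) ∞ G := by
    intro y
    have h2 : ContDiffAt ℝ ∞ (radialStretch (V := F)) (g y.1) :=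
      contDiffOn_radialStretch.contDiffAt (isOpen_ball.mem_nhds (mem_ball_zero_iff.2 y.2))
    exact ContDiffAt.comp_contMDiffAt (f := fun y : U => g y.1) (x := y) h2 (hg' y)
  have hGsurj : ∀ y : U, Surjective (mfderiv I 𝓘(ℝ, F) G y) := by
    intro y
    have hgd : MDifferentiableAt I 𝓘(ℝ, F) g y.1 := hg.mdifferentiableAt (by simp)
    have h1 : HasMFDerivAt I 𝓘(ℝ, F) (fun y : U => g y.1) y
        ((mfderiv I 𝓘(ℝ, F) g y.1).comp (ContinuousLinearMap.id ℝ E)) :=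
      hgd.hasMFDerivAt.comp y (OpenSubmanifold.hasMFDerivAt_subtype_val y)
    obtain ⟨L, hL, -⟩ := exists_hasFDerivAt_radialStretch (V := F) (u := g y.1) y.2
    have h2 : HasMFDerivAt I 𝓘(ℝ, F) G y
        (L.comp ((mfderiv I 𝓘(ℝ, F) g y.1).comp (ContinuousLinearMap.id ℝ E))) :=
      hL.hasMFDerivAt.comp y h1
    rw [h2.mfderiv]
    have hLs : Surjective L := by
      rw [← hL.fderiv]; exact surjective_fderiv_radialStretch y.2
    intro w
    obtain ⟨v, hv⟩ := hLs w
    obtain ⟨x, hx⟩ := hsub y.1 y.2 v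
    exact ⟨x, show L (mfderiv I 𝓘(ℝ, F) g y.1 x) = w by rw [hx, hv]⟩
  -- properness: preimages of closed balls are compact
  have hK : ∀ (w : F) (R : ℝ), IsCompact (G ⁻¹' closedBall w R) := by
    intro w R
    set R' : ℝ := ‖w‖ + |R| with hR'
    have hR'0 : 0 ≤ R' := by positivity
    set r' : ℝ := 2 * R' / (1 + 2 * R') with hr'
    have hr'1 : r' < 1 := by
      rw [hr', div_lt_one (by linarith)]; linarith
    set C : Set F := closedBall 0 r' ∩ radialStretch ⁻¹' closedBall w R with hC
    have hCc : IsClosed C :=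
      (contDiffOn_radialStretch.continuousOn.mono (closedBall_subset_ball hr'1)).preimage_isClosed_of_isClosed
        isClosed_closedBall isClosed_closedBall
    have hKc : IsCompact (g ⁻¹' C) := (hCc.preimage hg.continuous).isCompact
    have hKU : g ⁻¹' C ⊆ (U : Set N) := fun y hy =>
      hmemU.2 (lt_of_le_of_lt (mem_closedBall_zero_iff.1 hy.1) hr'1)
    have heq : G ⁻¹' closedBall w R = (Subtype.val : U → N) ⁻¹' (g ⁻¹' C) := by
      ext y
      simp only [mem_preimage, hC, mem_inter_iff, mem_closedBall_zero_iff]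
      constructor
      · intro hy
        refine ⟨?_, hy⟩
        have hn : ‖radialStretch (g y.1)‖ ≤ R' := by
          have h1 : dist (radialStretch (g y.1)) w ≤ R := mem_closedBall.1 hy
          rw [dist_eq_norm] at h1
          have h2 := norm_le_norm_sub_add (radialStretch (g y.1)) w
          rw [hR']
          linarith [le_abs_self R]
        exact norm_le_of_norm_radialStretch_le y.2 hn
      · intro hy; exact hy.2
    rw [heq]
    exact isCompact_preimage_val_of_subset hKc hKU
  -- the translating flow
  set c : F := radialStretch c₁ - radialStretch c₀ with hc
  obtain ⟨X, hXs, hXc⟩ := exists_contMDiff_lift_of_surjective_mfderiv hGs hGsurj c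
  obtain ⟨θ, hθs, hθ0, hθadd, -, hθG⟩ := exists_globalFlow_of_lift hGs hXs hXc hK
  have hθc : Continuous θ := hθs.continuous
  -- reading the level through the stretch
  have hread : ∀ {z : U} {a : F}, ‖a‖ < 1 → G z = radialStretch a → g z.1 = a :=
    fun {z a} ha h => radialStretch_injOn (mem_ball_zero_iff.2 z.2) (mem_ball_zero_iff.2 ha) h
  have hin₀ : ∀ y : {y : N // g y = c₀}, y.1 ∈ U := fun y => hmemU.2 (by rw [y.2]; exact hc₀)
  have hin₁ : ∀ y : {y : N // g y = c₁}, y.1 ∈ U := fun y => hmemU.2 (by rw [y.2]; exact hc₁)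
  have hto : ∀ y : {y : N // g y = c₀}, g (θ (1, ⟨y.1, hin₀ y⟩)).1 = c₁ := by
    intro y
    refine hread hc₁ ?_
    rw [hθG, one_smul]
    show radialStretch (g y.1) + (radialStretch c₁ - radialStretch c₀) = radialStretch c₁
    rw [y.2]; abel
  have hfro : ∀ y : {y : N // g y = c₁}, g (θ (-1, ⟨y.1, hin₁ y⟩)).1 = c₀ := by
    intro y
    refine hread hc₀ ?_
    rw [hθG, neg_smul, one_smul]
    show radialStretch (g y.1) + -(radialStretch c₁ - radialStretch c₀) = radialStretch c₀
    rw [y.2]; abel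
  refine ⟨{ toFun := fun y => ⟨(θ (1, ⟨y.1, hin₀ y⟩)).1, hto y⟩
            invFun := fun y => ⟨(θ (-1, ⟨y.1, hin₁ y⟩)).1, hfro y⟩
            left_inv := fun y => ?_
            right_inv := fun y => ?_
            continuous_toFun := ?_
            continuous_invFun := ?_ }⟩
  · apply Subtype.ext
    show (θ (-1, ⟨(θ (1, ⟨y.1, hin₀ y⟩)).1, _⟩)).1 = y.1
    have : (⟨(θ (1, ⟨y.1, hin₀ y⟩)).1, hin₁ ⟨_, hto y⟩⟩ : U) = θ (1, ⟨y.1, hin₀ y⟩) := rfl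
    rw [this, hθadd, show (-1 : ℝ) + 1 = 0 by norm_num, hθ0]
  · apply Subtype.ext
    show (θ (1, ⟨(θ (-1, ⟨y.1, hin₁ y⟩)).1, _⟩)).1 = y.1
    have : (⟨(θ (-1, ⟨y.1, hin₁ y⟩)).1, hin₀ ⟨_, hfro y⟩⟩ : U) = θ (-1, ⟨y.1, hin₁ y⟩) := rfl
    rw [this, hθadd, show (1 : ℝ) + -1 = 0 by norm_num, hθ0]
  · exact (continuous_subtype_val.comp (hθc.comp (continuous_const.prodMk
      (continuous_subtype_val.subtype_mk _)))).subtype_mk _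
  · exact (continuous_subtype_val.comp (hθc.comp (continuous_const.prodMk
      (continuous_subtype_val.subtype_mk _)))).subtype_mk _

end Levels

end Literature.Geometry.Manifold

end
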